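import Summits.BirchSwinnertonDyer.BirchSwinnertonDyer.Theorems.ClassRecordThreeHalvesAtThreeValueContinuity
import Summits.BirchSwinnertonDyer.BirchSwinnertonDyer.Theorems.KolyvaginRoadThreeHalvesTamAtThree
import HarnessLib

/-!
# Route `KolyvaginRoadThree`, crux `HalvesTamAtThree` (item stmt-BirchSwinnertonDyer-19155) — the H2 half
# `Three.BDPValueAt₃` from VALUE CONTINUITY AT `𝟙` (VC₃), and the item reduced to its H3 stub modulo (VC₃)

Cell `bsd-stepL` (run/shared/lean/pub/bsd-stepL/), seat `bsd-stepL-thmc-p1` (prover g2, D-0074 hands, 2026-08-26),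
`--supports stmt-BirchSwinnertonDyer-19155` (route `route-BirchSwinnertonDyer-KolyvaginRoadThree`, crux 4 =
`HalvesTamAtThree` = ClassRecordThree's `HalvesAtThree` with the extra binder `3 ∣ ∏ c_ℓ` on the (ram) ∧ 3-split
locus). Koly twin of `Theorems/ClassRecordThreeHalvesAtThreeValueContinuity.lean` (item 19107), exactly as
`Theorems/KolyvaginRoadThreeHalvesTamAtThree.lean` (g0) twins `Theorems/ClassRecordThreeHalvesAtThreeBDPValue.lean`.

## What this file records in the kernel

The frame-free hypothesis (VC₃) — at every X11b@3 classical Heegner datum and every `ι'` inducing `𝔭`, virtual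
periods `Ω_K ≠ 0`, `Ω_p ≠ 0` and `u ∈ R₀ˣ` such that Castella's display
`ι'⁻¹(bdpInterpolationValue 3 f 𝔭 φ_k n_k Ω_K)·Ω_p^{4n_k}` tends to `u·((1 − a₃(E)·3⁻¹)·log_{ω_E} P)²` along every
interpolation sequence with `r_k(γ) → 1`; NO `p`-adic `L`-function and NO `R₀`-integrality in it — quantified over
every curve, gives: (1) the H2 conjuncts of `HalvesTamAtThree` on both loci
(`kolyvaginRoadThree_halvesTamAtThree_bdpValue_of_valueContinuity`; the loci and Tamagawa binders are idle);
(2) `HalvesTamAtThree` ⟸ (VC₃) ∧ the item's own two-loci H3 statement with the Tamagawa binder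
(`…_of_valueContinuity_of_imcDivTamStub`); (3) `HalvesTamAtThree` ⟸ (VC₃) ∧ ClassRecordThree's registered H3 stub
`stub_imcDivAtThree` (`…_of_valueContinuity_of_imcDivStub`, through `halvesTamAtThree_of_halvesAtThree`). So item
19155 is its one open half H3 `Three.IMCDivAt₃` on {surj} ∩ ((ram) ⟹ 3 split ∧ 3 ∣ ∏c) modulo (VC₃) — an input
WEAKER than THEOREM C typed (`valueContinuity₃_of_classicalFrameValue`) whose content is the `3`-adic continuity
at `𝟙` of normalised special values (in print for any `p` and level at `𝔭` as Liu–Zhang–Zhang 2018 Thm. 3.8 ∕ 3.10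
modulo the constants dictionary; at `3 ∥ N` with classical data = PROOF-BDP §20 THEOREM C, a refereed MEMO theorem).

HONEST FRAMING: implications only; (VC₃) is NOT discharged, NOT a kernel theorem, NOT a Literature fact; H3 is
OPEN; nothing is booked; no node, label or census count moves (T7); BSD(E,3) is proved for no class by this file.

References: [Castella2018] Camb. J. Math. 6 (2018) = arXiv:1704.06608, Thm. 3.1–3.3 (pp. 8–9); [LiuZhangZhang2018]
Duke Math. J. 167, Thm. 3.8, Thm. 3.10; cell memo PROOF-BDP v1.8 §20 (THEOREM C); koly MEMO-v6 / plan/K2KOLY/v2.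
-/

noncomputable section

open scoped Classical Topology

open Filter WeierstrassCurve NumberField IsDedekindDomain Field PowerSeries
  Literature.NumberTheory.EllipticCurves Literature.NumberTheory.EllipticCurves.ModularForms
  Literature.NumberTheory.EllipticCurves.Rank1Residual
  Literature.NumberTheory.GaloisRepresentations Literature.NumberTheory.GaloisCohomology
  Summit.BirchSwinnertonDyer.Rank1Residual Summit.BirchSwinnertonDyer.Rank1Residual.X11b
  Summit.BirchSwinnertonDyer.Rank1Residual.X11b.AcSelmer
  Summit.BirchSwinnertonDyer.Rank1Residual.X11b.CongruenceLimit
  Summit.BirchSwinnertonDyer.Rank1Residual.X11b.Halves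
  Summit.BirchSwinnertonDyer.Rank1Residual.X11b.Three
  Summit.BirchSwinnertonDyer.BirchSwinnertonDyer.Theses.ClassRecordThree
  Summit.BirchSwinnertonDyer.BirchSwinnertonDyer.Theses.KolyvaginRoadThree

namespace Summit.BirchSwinnertonDyer.BirchSwinnertonDyer.Theorems

/-- **(VC₃) for every curve ⟹ the H2 half of crux `HalvesTamAtThree` on BOTH loci** — the conclusion is verbatim
the H2 conjuncts of the item's signature: for `E ∈ X11b` at 3, (ram) → 3 split → 3 ∣ ∏c → `BDPValueAt₃ W`, and
¬(ram) → surj → `BDPValueAt₃ W`. The loci and Tamagawa binders are idle ((VC₃) gives H2 for every X11b@3 curve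
with surjective image, `bdpValueAt₃_of_valueContinuity`; H2 is vacuous otherwise). CONDITIONAL on (VC₃).
[cite: Castella2018, Thm. 3.2 (arXiv:1704.06608 p. 9) (value shape only; antecedent = value continuity at 𝟙)] -/
theorem kolyvaginRoadThree_halvesTamAtThree_bdpValue_of_valueContinuity
    (hVC : ∀ (W : WeierstrassCurve ℚ) [W.IsElliptic] [W.IsGloballyMinimal],
      ∀ (N : ℕ) [NeZero N] (K : Type) [Field K] [NumberField K] (Dt : ModularParametrizationData W N)
      (H : HeegnerDatum N (NumberField.discr K)) (ι : K →+* ℂ) (P : (W.baseChange K).toAffine.Point),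
      ClassX11b W 3 → Surj W 3 → W.conductorNorm ℤ = N → IsImaginaryQuadratic K →
      Odd (NumberField.discr K) → SatisfiesHeegnerHypothesis N K →
      (W.quadraticTwist (NumberField.discr K : ℚ)).entireLFunction 1 ≠ 0 →
      WeierstrassCurve.Affine.Point.map ι.toRatAlgHom P = heegnerPointComplex Dt H →
      ¬ (3 : ℤ) ∣ Dt.c → ¬ IsOfFinAddOrder P →
      ∀ (κ : ZpExtension K 3), κ.IsAnticyclotomic →
        ∀ (γ : Field.absoluteGaloisGroup K) [Fact (κ.IsTopGenerator γ)]
          (𝔭 : HeightOneSpectrum (𝓞 K)) (h𝔭 : ((3 : ℕ) : 𝓞 K) ∈ 𝔭.asIdeal)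
          (he : 𝔭.asIdeal.ramificationIdx (𝓞 ℚ) = 1) (hf : 𝔭.asIdeal.inertiaDeg (𝓞 ℚ) = 1),
          ∀ (f : CuspForm (CongruenceSubgroup.Gamma0 N) 2), IsNewformOf W f →
            ∀ (ι' : PadicAlgCl 3 ≃+* ℂ), InducesPrime ι' 𝔭 →
              ∃ (ΩK : ℂ) (Ωp : ℂ_[3]) (u : (unrIntegers 3)ˣ), ΩK ≠ 0 ∧ Ωp ≠ 0 ∧
                ∀ (φ : ℕ → HeckeCharacter K) (n : ℕ → ℕ) (r : ℕ → FramedGaloisRep K (PadicAlgCl 3) 1),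
                  (∀ k, 0 < n k) → (∀ k (v : HeightOneSpectrum (𝓞 K)), (φ k).IsUnramifiedAt v) →
                  (∀ k, (φ k).HasInfinityType (fun _ ↦ (n k : ℤ)) (fun _ ↦ -(n k : ℤ))) →
                  (∀ k, IsPAdicAvatarOf ι' (φ k) (r k)) → (∀ k, FactorsThroughZp κ (r k)) →
                  Tendsto (fun k ↦ avatarValueAt (r k) γ) atTop (𝓝 1) →
                  Tendsto (fun k ↦ ((ι'.symm (bdpInterpolationValue 3 f 𝔭 (φ k) (n k) ΩK) :
                    PadicAlgCl 3) : ℂ_[3]) * Ωp ^ (4 * n k)) atTop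
                    (𝓝 (((u : unrIntegers 3) : ℂ_[3]) *
                      (algebraMap ℚ_[3] ℂ_[3] (((1 : ℚ_[3]) - ((W.LFunction 3 : ℤ) : ℚ_[3]) *
                        (3 : ℚ_[3])⁻¹) * logOmega W 3 (embAt K 3 𝔭 h𝔭 he hf) P)) ^ 2))) :
    ∀ (W : WeierstrassCurve ℚ) [W.IsElliptic] [W.IsGloballyMinimal],
      Summit.BirchSwinnertonDyer.Rank1Residual.ClassX11b W 3 →
        (Literature.NumberTheory.EllipticCurves.Rank1Residual.Ram W 3 →
            W.HasSplitMultiplicativeReductionAtPrime 3 → 3 ∣ W.tamagawaProduct →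
              Summit.BirchSwinnertonDyer.Rank1Residual.X11b.Three.BDPValueAt₃ W) ∧
          (¬ Literature.NumberTheory.EllipticCurves.Rank1Residual.Ram W 3 →
            Literature.NumberTheory.EllipticCurves.Rank1Residual.Surj W 3 →
              Summit.BirchSwinnertonDyer.Rank1Residual.X11b.Three.BDPValueAt₃ W) :=
  fun W _ _ _ ↦
    ⟨fun _ _ _ ↦ bdpValueAt₃_of_valueContinuity (hVC W), fun _ _ ↦ bdpValueAt₃_of_valueContinuity (hVC W)⟩

/-- **The item reduced to its own H3 statement, modulo (VC₃).** `HalvesTamAtThree` follows from (VC₃) for every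
curve and the two-loci H3 statement WITH the Tamagawa binder ((ram) → 3 split → 3 ∣ ∏c → `IMCDivAt₃ W`; ¬(ram) →
surj → `IMCDivAt₃ W`) — the shape of the BC3 stub `stub_imcDivTamAtThree`. H3 is OPEN; nothing is discharged.
[cite: Castella2018, Thm. 3.3 (arXiv:1704.06608 p. 9) (shape of H3 only; open at p = 3)] -/
theorem kolyvaginRoadThree_halvesTamAtThree_of_valueContinuity_of_imcDivTamStub
    (hVC : ∀ (W : WeierstrassCurve ℚ) [W.IsElliptic] [W.IsGloballyMinimal],
      ∀ (N : ℕ) [NeZero N] (K : Type) [Field K] [NumberField K] (Dt : ModularParametrizationData W N)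
      (H : HeegnerDatum N (NumberField.discr K)) (ι : K →+* ℂ) (P : (W.baseChange K).toAffine.Point),
      ClassX11b W 3 → Surj W 3 → W.conductorNorm ℤ = N → IsImaginaryQuadratic K →
      Odd (NumberField.discr K) → SatisfiesHeegnerHypothesis N K →
      (W.quadraticTwist (NumberField.discr K : ℚ)).entireLFunction 1 ≠ 0 →
      WeierstrassCurve.Affine.Point.map ι.toRatAlgHom P = heegnerPointComplex Dt H →
      ¬ (3 : ℤ) ∣ Dt.c → ¬ IsOfFinAddOrder P →
      ∀ (κ : ZpExtension K 3), κ.IsAnticyclotomic →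
        ∀ (γ : Field.absoluteGaloisGroup K) [Fact (κ.IsTopGenerator γ)]
          (𝔭 : HeightOneSpectrum (𝓞 K)) (h𝔭 : ((3 : ℕ) : 𝓞 K) ∈ 𝔭.asIdeal)
          (he : 𝔭.asIdeal.ramificationIdx (𝓞 ℚ) = 1) (hf : 𝔭.asIdeal.inertiaDeg (𝓞 ℚ) = 1),
          ∀ (f : CuspForm (CongruenceSubgroup.Gamma0 N) 2), IsNewformOf W f →
            ∀ (ι' : PadicAlgCl 3 ≃+* ℂ), InducesPrime ι' 𝔭 →
              ∃ (ΩK : ℂ) (Ωp : ℂ_[3]) (u : (unrIntegers 3)ˣ), ΩK ≠ 0 ∧ Ωp ≠ 0 ∧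
                ∀ (φ : ℕ → HeckeCharacter K) (n : ℕ → ℕ) (r : ℕ → FramedGaloisRep K (PadicAlgCl 3) 1),
                  (∀ k, 0 < n k) → (∀ k (v : HeightOneSpectrum (𝓞 K)), (φ k).IsUnramifiedAt v) →
                  (∀ k, (φ k).HasInfinityType (fun _ ↦ (n k : ℤ)) (fun _ ↦ -(n k : ℤ))) →
                  (∀ k, IsPAdicAvatarOf ι' (φ k) (r k)) → (∀ k, FactorsThroughZp κ (r k)) →
                  Tendsto (fun k ↦ avatarValueAt (r k) γ) atTop (𝓝 1) →
                  Tendsto (fun k ↦ ((ι'.symm (bdpInterpolationValue 3 f 𝔭 (φ k) (n k) ΩK) :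
                    PadicAlgCl 3) : ℂ_[3]) * Ωp ^ (4 * n k)) atTop
                    (𝓝 (((u : unrIntegers 3) : ℂ_[3]) *
                      (algebraMap ℚ_[3] ℂ_[3] (((1 : ℚ_[3]) - ((W.LFunction 3 : ℤ) : ℚ_[3]) *
                        (3 : ℚ_[3])⁻¹) * logOmega W 3 (embAt K 3 𝔭 h𝔭 he hf) P)) ^ 2)))
    (h3 : ∀ (W : WeierstrassCurve ℚ) [W.IsElliptic] [W.IsGloballyMinimal], ClassX11b W 3 →
      (Ram W 3 → W.HasSplitMultiplicativeReductionAtPrime 3 → 3 ∣ W.tamagawaProduct → IMCDivAt₃ W) ∧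
        (¬ Ram W 3 → Surj W 3 → IMCDivAt₃ W)) :
    HalvesTamAtThree := by
  unfold HalvesTamAtThree
  intro W _ _ hX
  obtain ⟨hI₁, hI₂⟩ := h3 W hX
  exact ⟨fun hr hs ht ↦ ⟨bdpValueAt₃_of_valueContinuity (hVC W), hI₁ hr hs ht⟩,
    fun hnr hsu ↦ ⟨bdpValueAt₃_of_valueContinuity (hVC W), hI₂ hnr hsu⟩⟩

/-- Modulo (VC₃) for every curve, ClassRecordThree's registered two-loci H3 stub (`stub_imcDivAtThree` of item
19107, no Tamagawa binder) already gives `HalvesTamAtThree` (through `HalvesAtThree`,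
`halvesTamAtThree_of_halvesAtThree`). [folklore] -/
theorem kolyvaginRoadThree_halvesTamAtThree_of_valueContinuity_of_imcDivStub
    (hVC : ∀ (W : WeierstrassCurve ℚ) [W.IsElliptic] [W.IsGloballyMinimal],
      ∀ (N : ℕ) [NeZero N] (K : Type) [Field K] [NumberField K] (Dt : ModularParametrizationData W N)
      (H : HeegnerDatum N (NumberField.discr K)) (ι : K →+* ℂ) (P : (W.baseChange K).toAffine.Point),
      ClassX11b W 3 → Surj W 3 → W.conductorNorm ℤ = N → IsImaginaryQuadratic K →
      Odd (NumberField.discr K) → SatisfiesHeegnerHypothesis N K →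
      (W.quadraticTwist (NumberField.discr K : ℚ)).entireLFunction 1 ≠ 0 →
      WeierstrassCurve.Affine.Point.map ι.toRatAlgHom P = heegnerPointComplex Dt H →
      ¬ (3 : ℤ) ∣ Dt.c → ¬ IsOfFinAddOrder P →
      ∀ (κ : ZpExtension K 3), κ.IsAnticyclotomic →
        ∀ (γ : Field.absoluteGaloisGroup K) [Fact (κ.IsTopGenerator γ)]
          (𝔭 : HeightOneSpectrum (𝓞 K)) (h𝔭 : ((3 : ℕ) : 𝓞 K) ∈ 𝔭.asIdeal)
          (he : 𝔭.asIdeal.ramificationIdx (𝓞 ℚ) = 1) (hf : 𝔭.asIdeal.inertiaDeg (𝓞 ℚ) = 1),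
          ∀ (f : CuspForm (CongruenceSubgroup.Gamma0 N) 2), IsNewformOf W f →
            ∀ (ι' : PadicAlgCl 3 ≃+* ℂ), InducesPrime ι' 𝔭 →
              ∃ (ΩK : ℂ) (Ωp : ℂ_[3]) (u : (unrIntegers 3)ˣ), ΩK ≠ 0 ∧ Ωp ≠ 0 ∧
                ∀ (φ : ℕ → HeckeCharacter K) (n : ℕ → ℕ) (r : ℕ → FramedGaloisRep K (PadicAlgCl 3) 1),
                  (∀ k, 0 < n k) → (∀ k (v : HeightOneSpectrum (𝓞 K)), (φ k).IsUnramifiedAt v) →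
                  (∀ k, (φ k).HasInfinityType (fun _ ↦ (n k : ℤ)) (fun _ ↦ -(n k : ℤ))) →
                  (∀ k, IsPAdicAvatarOf ι' (φ k) (r k)) → (∀ k, FactorsThroughZp κ (r k)) →
                  Tendsto (fun k ↦ avatarValueAt (r k) γ) atTop (𝓝 1) →
                  Tendsto (fun k ↦ ((ι'.symm (bdpInterpolationValue 3 f 𝔭 (φ k) (n k) ΩK) :
                    PadicAlgCl 3) : ℂ_[3]) * Ωp ^ (4 * n k)) atTop
                    (𝓝 (((u : unrIntegers 3) : ℂ_[3]) *
                      (algebraMap ℚ_[3] ℂ_[3] (((1 : ℚ_[3]) - ((W.LFunction 3 : ℤ) : ℚ_[3]) *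
                        (3 : ℚ_[3])⁻¹) * logOmega W 3 (embAt K 3 𝔭 h𝔭 he hf) P)) ^ 2)))
    (h3 : ∀ (W : WeierstrassCurve ℚ) [W.IsElliptic] [W.IsGloballyMinimal], ClassX11b W 3 →
      (Ram W 3 → W.HasSplitMultiplicativeReductionAtPrime 3 → IMCDivAt₃ W) ∧
        (¬ Ram W 3 → Surj W 3 → IMCDivAt₃ W)) :
    HalvesTamAtThree :=
  halvesTamAtThree_of_halvesAtThree (classRecordThree_halvesAtThree_of_valueContinuity_of_imcDivStub hVC h3)

end Summit.BirchSwinnertonDyer.BirchSwinnertonDyer.Theorems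

end
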